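import Literature.Analysis.ValidatedNumerics.TaylorModelIntegralCertImproper
import HarnessLib

/-!
# Improper-integral certificates for straight-line programs: the bounded factor on the half-line

Trunk T-ANA (Analysis/ValidatedNumerics); namespaces `Literature.Analysis.ValidatedNumerics.NumericsMP` (extended
intervals) and `Literature.Analysis.ValidatedNumerics.PolyMP` (programs, certificates).

`TaylorModelIntegralCertImproper.lean` certifies a remainder `∫_{(u,∞)} f·g` (Lemma 5 of Mahboubi–Melquiond–
Sibut-Pinote) from an interval `F ∋ f(x)` (`x > u`) supplied BY THE USER (`tailCheckI` / `tailCheckR`).  This file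
computes that interval in the kernel, as op. cit. does: "`F(hull(u, +∞))`", the natural interval extension of the
bounded factor evaluated on the UNBOUNDED input interval `[u, +∞)`.  Following Melquiond's `interval` library, an
interval is a pair of bounds each of which may be absent (`⊥`, an infinite bound): here `XI = Option ℤ × Option ℤ` at
scale `S` (`none` = `−∞` / `+∞`), with the interval extensions of the statements of the straight-line programs
`SProg` of `TaylorModelIntegralCertSLP.lean` / `…CertParam.lean` (`+`, `−`, `×` by sign analysis, `1/·`, `√`,
`log`, `exp`, exact polynomials and `e^{a+bt}` of the variable, recentred at `u` so that the variable's interval is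
exactly `[0, +∞)`).

## Main definitions

* `XI`, `XI.mem S x I`; `XI.add`, `XI.neg`, `XI.mul`, `XI.inv`, `XI.sqrt` (integer roots by the structurally
  recursive bisection `sqrtBounds`, kernel-evaluable), `XI.log`, `XI.exp` (total operations, `⊤ = (none, none)` where
  nothing is known).
* `SOp.rangeX`, `SProg.runX`, `SProg.rangeHL S P p B u : XI` — the range of the program's function on `[u, +∞)`, for all
  parameters in the box `B`.
* `tailCheck S P s p B u lo hi : Bool` — the automatic form of Lemma 5: `decide (0 < S)`, the range is finite, and
  `tailCheckI` of the previous file accepts it.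

## Main theorems (soundness)

* `XI.mem_add`, `XI.mem_neg`, `XI.mem_mul`, `XI.mem_inv`, `XI.mem_sqrt`, `XI.mem_log`, `XI.mem_exp`.
* `SProg.mem_rangeHL`: `x ≥ u`, `ps ∈ B` ⟹ `p.toFunP ps x ∈ p.rangeHL S P B u`.
* `ftailOK_of_tailCheck`: `tailCheck … = true`, `ps ∈ B` ⟹ `FTailOK (p.toFunP ps · s.toFun) S u lo hi`.
* `integral_Ioi_of_seg_tail`: gluing a proper enclosure on `[a, b]` and a remainder enclosure on `(b, ∞)` into an
  enclosure of `∫_{(a,∞)}` (with integrability on `(a, ∞)`).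

## References

* G. Melquiond, Proving bounds on real-valued functions with computations, IJCAR 2008, LNCS 5195, Sect. 2.2 (intervals
  as pairs of possibly infinite bounds; interval extensions), Sect. 3.3 (interval evaluation of straight-line programs).
* A. Mahboubi, G. Melquiond, T. Sibut-Pinote, Formally verified approximations of definite integrals, J. Automated
  Reasoning 62 (2019) 281–300, Sect. 4.1 (Lemma 5: `F(hull(u,+∞))`; splitting `∫_u^∞ = ∫_u^v + ∫_v^∞`).
-/

open MeasureTheory intervalIntegral Set

namespace Literature.Analysis.ValidatedNumerics

namespace NumericsMP

/-! ### Extended intervals: pairs of possibly infinite bounds -/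

/-- An interval at scale `S` whose bounds may be infinite: `lo = none` is `−∞`, `hi = none` is `+∞` (the pairs of
"extended numbers" of op. cit.). [cite: Melquiond2008, Sect. 2.2] -/
structure XI where
  /-- lower bound `lo / S`, or `−∞` -/
  lo : Option ℤ
  /-- upper bound `hi / S`, or `+∞` -/
  hi : Option ℤ
  deriving DecidableEq, Repr, Inhabited

namespace XI

variable {S : ℕ} {x y : ℝ} {I J : XI}

/-- A possibly infinite LOWER bound holds for `x` at scale `S`. [cite: Melquiond2008, Sect. 2.2] -/
def LB (S : ℕ) (x : ℝ) : Option ℤ → Prop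
  | none => True
  | some l => (l : ℝ) ≤ x * S

/-- A possibly infinite UPPER bound holds for `x` at scale `S`. [cite: Melquiond2008, Sect. 2.2] -/
def UB (S : ℕ) (x : ℝ) : Option ℤ → Prop
  | none => True
  | some h => x * S ≤ (h : ℝ)

/-- [cite: Melquiond2008, Sect. 2.2] -/
@[simp] theorem LB_none : LB S x none := trivial

/-- [cite: Melquiond2008, Sect. 2.2] -/
@[simp] theorem LB_some {l : ℤ} : LB S x (some l) ↔ (l : ℝ) ≤ x * S := Iff.rfl

/-- [cite: Melquiond2008, Sect. 2.2] -/
@[simp] theorem UB_none : UB S x none := trivial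

/-- [cite: Melquiond2008, Sect. 2.2] -/
@[simp] theorem UB_some {h : ℤ} : UB S x (some h) ↔ x * S ≤ (h : ℝ) := Iff.rfl

/-- `x ∈ I` at scale `S` (the "contains" relation of op. cit.). [cite: Melquiond2008, Sect. 2.2] -/
def mem (S : ℕ) (x : ℝ) (I : XI) : Prop := LB S x I.lo ∧ UB S x I.hi

/-- The whole line `(−∞, +∞)`. [cite: Melquiond2008, Sect. 2.2] -/
def top : XI := ⟨none, none⟩

/-- Every real lies in `⊤`. [cite: Melquiond2008, Sect. 2.2] -/
theorem mem_top : mem S x top := ⟨trivial, trivial⟩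

/-- The point `0`. [cite: Melquiond2008, Sect. 2.2] -/
def zero : XI := ⟨some 0, some 0⟩

/-- `0 ∈ zero`. [cite: Melquiond2008, Sect. 2.2] -/
theorem mem_zero : mem S 0 zero := by
  simp [mem, zero]

/-- The half-line `[0, +∞)`. [cite: Melquiond2008, Sect. 2.2] -/
def nonnegHL : XI := ⟨some 0, none⟩

/-- A nonnegative real lies in `[0, +∞)`. [cite: Melquiond2008, Sect. 2.2] -/
theorem mem_nonnegHL (hx : 0 ≤ x) : mem S x nonnegHL :=
  ⟨by simp only [nonnegHL, LB_some, Int.cast_zero]; positivity, trivial⟩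

/-- A finite interval as an extended one. [cite: Melquiond2008, Sect. 2.2] -/
def ofMI (A : MI) : XI := ⟨some A.lo, some A.hi⟩

/-- [cite: Melquiond2008, Sect. 2.2] -/
theorem mem_ofMI {A : MI} (h : MI.mem S x A) : mem S x (ofMI A) := ⟨h.1, h.2⟩

/-- The finite interval of an extended one, when both bounds are finite. [cite: Melquiond2008, Sect. 2.2] -/
def fin? : XI → Option MI
  | ⟨some l, some h⟩ => some ⟨l, h⟩
  | _ => none

/-- [cite: Melquiond2008, Sect. 2.2] -/
theorem mem_fin? {A : MI} (h : I.fin? = some A) (hx : mem S x I) : MI.mem S x A := by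
  rcases I with ⟨_ | l, _ | k⟩ <;> simp [fin?] at h
  subst h
  exact ⟨hx.1, hx.2⟩

/-! ### Addition and negation -/

/-- Sum of two bounds of the same side (infinite if either is). [cite: Melquiond2008, Sect. 2.2] -/
def addB : Option ℤ → Option ℤ → Option ℤ
  | some a, some b => some (a + b)
  | _, _ => none

/-- `(l₁, u₁) + (l₂, u₂) = (l₁ + l₂, u₁ + u₂)`. [cite: Melquiond2008, Sect. 2.2] -/
def add (I J : XI) : XI := ⟨addB I.lo J.lo, addB I.hi J.hi⟩

/-- [folklore] -/
private theorem LB_addB {a b : Option ℤ} (h1 : LB S x a) (h2 : LB S y b) : LB S (x + y) (addB a b) := by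
  rcases a with _ | a <;> rcases b with _ | b <;> simp only [addB, LB_none, LB_some] at *
  push_cast; linarith

/-- [folklore] -/
private theorem UB_addB {a b : Option ℤ} (h1 : UB S x a) (h2 : UB S y b) : UB S (x + y) (addB a b) := by
  rcases a with _ | a <;> rcases b with _ | b <;> simp only [addB, UB_none, UB_some] at *
  push_cast; linarith

/-- Interval extension of `+`. [cite: Melquiond2008, Sect. 2.2] -/
theorem mem_add (hx : mem S x I) (hy : mem S y J) : mem S (x + y) (add I J) :=
  ⟨LB_addB hx.1 hy.1, UB_addB hx.2 hy.2⟩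

/-- `−(l, u) = (−u, −l)`. [cite: Melquiond2008, Sect. 2.2] -/
def neg (I : XI) : XI := ⟨I.hi.map (fun a => -a), I.lo.map (fun a => -a)⟩

/-- Interval extension of unary `−`. [cite: Melquiond2008, Sect. 2.2] -/
theorem mem_neg (hx : mem S x I) : mem S (-x) (neg I) := by
  obtain ⟨h1, h2⟩ := hx
  rcases I with ⟨_ | l, _ | k⟩ <;> simp only [neg, Option.map, mem, LB_none, LB_some, UB_none, UB_some] at * <;>
    constructor <;> (try trivial) <;> push_cast <;> linarith

/-! ### Sign tests and multiplication -/

/-- The interval lies in `[0, +∞)` (finite nonnegative lower bound). [cite: Melquiond2008, Sect. 2.2] -/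
def nonneg (I : XI) : Bool :=
  match I.lo with
  | some l => decide (0 ≤ l)
  | none => false

/-- The interval lies in `(−∞, 0]`. [cite: Melquiond2008, Sect. 2.2] -/
def nonpos (I : XI) : Bool :=
  match I.hi with
  | some h => decide (h ≤ 0)
  | none => false

/-- [folklore] -/
private theorem nonneg_neg (h : I.nonpos = true) : (neg I).nonneg = true := by
  rcases I with ⟨lo, _ | k⟩
  · simp [nonpos] at h
  · simp only [nonpos, decide_eq_true_eq] at h
    simp [neg, nonneg, h]

/-- [folklore] `⌊a/d⌋ ≤ P/d` when `a ≤ P`. -/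
private theorem floor_div_le {a d : ℤ} {P : ℝ} (hd : 0 < d) (h : (a : ℝ) ≤ P) : ((a / d : ℤ) : ℝ) ≤ P / d := by
  have hdr : (0 : ℝ) < d := by exact_mod_cast hd
  rw [le_div_iff₀ hdr]
  have h1 : a / d * d ≤ a := Int.ediv_mul_le a hd.ne'
  calc ((a / d : ℤ) : ℝ) * d = ((a / d * d : ℤ) : ℝ) := by push_cast; ring
    _ ≤ a := by exact_mod_cast h1
    _ ≤ P := h

/-- [folklore] `P/d ≤ ⌈a/d⌉ = −⌊−a/d⌋` when `P ≤ a`. -/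
private theorem le_ceil_div {a d : ℤ} {P : ℝ} (hd : 0 < d) (h : P ≤ (a : ℝ)) :
    P / d ≤ ((-((-a) / d) : ℤ) : ℝ) := by
  have hdr : (0 : ℝ) < d := by exact_mod_cast hd
  rw [div_le_iff₀ hdr]
  have h1 : (-a) / d * d ≤ -a := Int.ediv_mul_le (-a) hd.ne'
  have h2 : (((-a) / d * d : ℤ) : ℝ) ≤ ((-a : ℤ) : ℝ) := by exact_mod_cast h1
  push_cast at h2 ⊢
  linarith

/-- Product of two intervals of `[0, +∞)` given by their (nonnegative) lower bounds and optional upper bounds: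
`(⌊l₁l₂/S⌋, ⌈u₁u₂/S⌉ or +∞)`, a zero factor absorbing an infinite one. [cite: Melquiond2008, Sect. 2.2] -/
def mulNN (S : ℕ) (l₁ l₂ : ℤ) (h₁ h₂ : Option ℤ) : XI :=
  ⟨some (l₁ * l₂ / S),
    match h₁, h₂ with
    | some a, some b => some (-((-(a * b)) / S))
    | some a, none => if a ≤ 0 then some 0 else none
    | none, some b => if b ≤ 0 then some 0 else none
    | none, none => none⟩

/-- [cite: Melquiond2008, Sect. 2.2] -/
theorem mem_mulNN (hS : 0 < S) {l₁ l₂ : ℤ} {h₁ h₂ : Option ℤ} (hl₁ : 0 ≤ l₁) (hl₂ : 0 ≤ l₂)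
    (hx : mem S x ⟨some l₁, h₁⟩) (hy : mem S y ⟨some l₂, h₂⟩) : mem S (x * y) (mulNN S l₁ l₂ h₁ h₂) := by
  have hSr : (0 : ℝ) < S := by exact_mod_cast hS
  have hSz : (0 : ℤ) < S := by exact_mod_cast hS
  obtain ⟨hx1, hx2⟩ := hx
  obtain ⟨hy1, hy2⟩ := hy
  simp only [LB_some] at hx1 hy1
  have hl₁r : (0 : ℝ) ≤ l₁ := by exact_mod_cast hl₁
  have hl₂r : (0 : ℝ) ≤ l₂ := by exact_mod_cast hl₂
  have hxS : 0 ≤ x * S := hl₁r.trans hx1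
  have hyS : 0 ≤ y * S := hl₂r.trans hy1
  have key : x * y * S = (x * S) * (y * S) / S := by field_simp
  refine ⟨?_, ?_⟩
  · show ((l₁ * l₂ / S : ℤ) : ℝ) ≤ x * y * S
    rw [key]
    have := floor_div_le (a := l₁ * l₂) (P := (x * S) * (y * S)) hSz
      (by push_cast; exact mul_le_mul hx1 hy1 hl₂r hxS)
    simpa using this
  · rcases h₁ with _ | a <;> rcases h₂ with _ | b <;> dsimp only [mulNN]
    · trivial
    · simp only [UB_some] at hy2
      split_ifs with hb
      · show x * y * S ≤ ((0 : ℤ) : ℝ)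
        have hbr : (b : ℝ) ≤ 0 := by exact_mod_cast hb
        have hy0 : y * S = 0 := le_antisymm (hy2.trans hbr) hyS
        have : y = 0 := by
          rcases mul_eq_zero.1 hy0 with h | h
          · exact h
          · exact absurd h hSr.ne'
        simp [this]
      · trivial
    · simp only [UB_some] at hx2
      split_ifs with ha
      · show x * y * S ≤ ((0 : ℤ) : ℝ)
        have har : (a : ℝ) ≤ 0 := by exact_mod_cast ha
        have hx0 : x * S = 0 := le_antisymm (hx2.trans har) hxS
        have : x = 0 := by
          rcases mul_eq_zero.1 hx0 with h | h
          · exact h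
          · exact absurd h hSr.ne'
        simp [this]
      · trivial
    · simp only [UB_some] at hx2 hy2
      show x * y * S ≤ ((-((-(a * b)) / S) : ℤ) : ℝ)
      rw [key]
      have := le_ceil_div (a := a * b) (P := (x * S) * (y * S)) hSz
        (by push_cast; exact mul_le_mul hx2 hy2 hyS (hxS.trans hx2))
      simpa using this

/-- `mulNN` on two intervals known to be nonnegative (else `⊤`). [cite: Melquiond2008, Sect. 2.2] -/
def mulNN' (S : ℕ) (I J : XI) : XI :=
  match I.lo, J.lo with
  | some l₁, some l₂ => mulNN S l₁ l₂ I.hi J.hi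
  | _, _ => top

/-- [cite: Melquiond2008, Sect. 2.2] -/
theorem mem_mulNN' (hS : 0 < S) (hI : I.nonneg = true) (hJ : J.nonneg = true) (hx : mem S x I) (hy : mem S y J) :
    mem S (x * y) (mulNN' S I J) := by
  rcases I with ⟨_ | l₁, h₁⟩
  · simp [nonneg] at hI
  rcases J with ⟨_ | l₂, h₂⟩
  · simp [nonneg] at hJ
  simp only [nonneg, decide_eq_true_eq] at hI hJ
  exact mem_mulNN hS hI hJ hx hy

/-- Interval extension of `×`: the finite case by `MI.mul`, otherwise by the signs of the operands (`⊤` when a sign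
is unknown). [cite: Melquiond2008, Sect. 2.2] -/
def mul (S : ℕ) (I J : XI) : XI :=
  match I, J with
  | ⟨some a, some b⟩, ⟨some c, some d⟩ => ofMI (MI.mul S ⟨a, b⟩ ⟨c, d⟩)
  | I, J =>
    if I.nonneg && J.nonneg then mulNN' S I J
    else if I.nonneg && J.nonpos then neg (mulNN' S I (neg J))
    else if I.nonpos && J.nonneg then neg (mulNN' S (neg I) J)
    else if I.nonpos && J.nonpos then mulNN' S (neg I) (neg J)
    else top

/-- [folklore] -/
private theorem mem_mul_signs (hS : 0 < S) (hx : mem S x I) (hy : mem S y J) :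
    mem S (x * y)
      (if I.nonneg && J.nonneg then mulNN' S I J
        else if I.nonneg && J.nonpos then neg (mulNN' S I (neg J))
        else if I.nonpos && J.nonneg then neg (mulNN' S (neg I) J)
        else if I.nonpos && J.nonpos then mulNN' S (neg I) (neg J)
        else top) := by
  split_ifs with h1 h2 h3 h4
  · simp only [Bool.and_eq_true] at h1
    exact mem_mulNN' hS h1.1 h1.2 hx hy
  · simp only [Bool.and_eq_true] at h2
    have := mem_neg (mem_mulNN' hS h2.1 (nonneg_neg h2.2) hx (mem_neg hy))
    simpa using this
  · simp only [Bool.and_eq_true] at h3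
    have := mem_neg (mem_mulNN' hS (nonneg_neg h3.1) h3.2 (mem_neg hx) hy)
    simpa using this
  · simp only [Bool.and_eq_true] at h4
    have := mem_mulNN' hS (nonneg_neg h4.1) (nonneg_neg h4.2) (mem_neg hx) (mem_neg hy)
    simpa using this
  · exact mem_top

/-- Interval extension of `×`. [cite: Melquiond2008, Sect. 2.2] -/
theorem mem_mul (hS : 0 < S) (hx : mem S x I) (hy : mem S y J) : mem S (x * y) (mul S I J) := by
  unfold mul
  split
  · rename_i a b c d
    exact mem_ofMI (MI.mem_mul hS (I := ⟨a, b⟩) (J := ⟨c, d⟩) ⟨hx.1, hx.2⟩ ⟨hy.1, hy.2⟩)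
  · exact mem_mul_signs hS hx hy

/-! ### Reciprocal, square root, logarithm, exponential -/

/-- Reciprocal of an interval of `(0, +∞)` with lower bound `l > 0`: `(⌊S²/u⌋ or 0, ⌈S²/l⌉)`.
[cite: Melquiond2008, Sect. 2.2] -/
def invPos (S : ℕ) (l : ℤ) (hi : Option ℤ) : XI :=
  ⟨some (match hi with
      | some h => if 0 < h then (S : ℤ) * S / h else 0
      | none => 0),
    some (-((-((S : ℤ) * S)) / l))⟩

/-- [cite: Melquiond2008, Sect. 2.2] -/
theorem mem_invPos (hS : 0 < S) {l : ℤ} {hi : Option ℤ} (hl : 0 < l) (hx : mem S x ⟨some l, hi⟩) :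
    mem S x⁻¹ (invPos S l hi) := by
  have hSr : (0 : ℝ) < S := by exact_mod_cast hS
  obtain ⟨hx1, hx2⟩ := hx
  simp only [LB_some] at hx1
  have hlr : (0 : ℝ) < l := by exact_mod_cast hl
  have hxS : 0 < x * S := hlr.trans_le hx1
  have hx0 : 0 < x := by
    by_contra h
    push Not at h
    nlinarith
  refine ⟨?_, ?_⟩
  · rcases hi with _ | h
    · show ((0 : ℤ) : ℝ) ≤ x⁻¹ * S
      push_cast; positivity
    · simp only [UB_some] at hx2
      show (((if 0 < h then (S : ℤ) * S / h else 0) : ℤ) : ℝ) ≤ x⁻¹ * S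
      split_ifs with hh
      · have hhr : (0 : ℝ) < h := by exact_mod_cast hh
        have key : (((S : ℤ) * S : ℤ) : ℝ) ≤ x⁻¹ * S * h := by
          push_cast
          calc ((S : ℝ) * S) = x⁻¹ * S * (x * S) := by field_simp
            _ ≤ x⁻¹ * S * h := mul_le_mul_of_nonneg_left hx2 (by positivity)
        have := floor_div_le (a := (S : ℤ) * S) hh key
        rwa [mul_div_cancel_right₀ _ hhr.ne'] at this
      · push_cast; positivity
  · show x⁻¹ * S ≤ ((-((-((S : ℤ) * S)) / l) : ℤ) : ℝ)
    have key : x⁻¹ * S * l ≤ (((S : ℤ) * S : ℤ) : ℝ) := by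
      push_cast
      calc x⁻¹ * S * l ≤ x⁻¹ * S * (x * S) := mul_le_mul_of_nonneg_left hx1 (by positivity)
        _ = (S : ℝ) * S := by field_simp
    have := le_ceil_div (a := (S : ℤ) * S) hl key
    rwa [mul_div_cancel_right₀ _ hlr.ne'] at this

/-- Interval extension of `1/·`: by `invPos` on `(0, +∞)`, by `−invPos(−·)` on `(−∞, 0)`, `⊤` when the operand may
vanish (the real semantics has the junk value `0⁻¹ = 0`, still enclosed). [cite: Melquiond2008, Sect. 2.2] -/
def inv (S : ℕ) (I : XI) : XI :=
  match I with
  | ⟨some l, hi⟩ =>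
    if 0 < l then invPos S l hi
    else
      match hi with
      | some h => if h < 0 then neg (invPos S (-h) (some (-l))) else top
      | none => top
  | ⟨none, some h⟩ => if h < 0 then neg (invPos S (-h) none) else top
  | ⟨none, none⟩ => top

/-- Interval extension of `1/·`. [cite: Melquiond2008, Sect. 2.2] -/
theorem mem_inv (hS : 0 < S) (hx : mem S x I) : mem S x⁻¹ (inv S I) := by
  rcases I with ⟨_ | l, _ | h⟩
  · exact mem_top
  · show mem S x⁻¹ (if h < 0 then neg (invPos S (-h) none) else top)
    split_ifs with hh
    · have hn : mem S (-x) ⟨some (-h), none⟩ := mem_neg hx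
      have := mem_neg (mem_invPos hS (by omega) hn)
      simpa [inv_neg] using this
    · exact mem_top
  · show mem S x⁻¹ (if 0 < l then invPos S l none else top)
    split_ifs with hl
    · exact mem_invPos hS hl hx
    · exact mem_top
  · show mem S x⁻¹ (if 0 < l then invPos S l (some h) else (if h < 0 then neg (invPos S (-h) (some (-l))) else top))
    split_ifs with hl hh
    · exact mem_invPos hS hl hx
    · have hn : mem S (-x) ⟨some (-h), some (-l)⟩ := mem_neg hx
      have := mem_neg (mem_invPos hS (by omega) hn)
      simpa [inv_neg] using this
    · exact mem_top

/-- Bisection for the integer square root with explicit fuel: from `lo² ≤ n < hi²` it returns a pair with the same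
property (structural recursion, so that the kernel evaluates it). [folklore] -/
def sqrtBisect (n : ℕ) : ℕ → ℕ → ℕ → ℕ × ℕ
  | 0, lo, hi => (lo, hi)
  | fuel + 1, lo, hi =>
    if hi ≤ lo + 1 then (lo, hi)
    else if (lo + hi) / 2 * ((lo + hi) / 2) ≤ n then sqrtBisect n fuel ((lo + hi) / 2) hi
    else sqrtBisect n fuel lo ((lo + hi) / 2)

/-- [folklore] -/
private theorem sqrtBisect_spec (n : ℕ) : ∀ (fuel lo hi : ℕ), lo * lo ≤ n → n < hi * hi →
    (sqrtBisect n fuel lo hi).1 * (sqrtBisect n fuel lo hi).1 ≤ n ∧ n < (sqrtBisect n fuel lo hi).2 * (sqrtBisect n fuel lo hi).2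
  | 0, lo, hi, h1, h2 => ⟨h1, h2⟩
  | fuel + 1, lo, hi, h1, h2 => by
      rw [sqrtBisect]
      split_ifs with h h'
      · exact ⟨h1, h2⟩
      · exact sqrtBisect_spec n fuel _ _ h' h2
      · exact sqrtBisect_spec n fuel _ _ h1 (not_le.1 h')

/-- Lower and upper integer bounds `(r, r')` of `√n`: `r² ≤ n < r'²` (exactly `(⌊√n⌋, ⌊√n⌋ + 1)` when the fuel
exceeds `log₂ n`). [folklore] -/
def sqrtBounds (fuel n : ℕ) : ℕ × ℕ := sqrtBisect n fuel 0 (n + 1)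

/-- [folklore] -/
private theorem sqrtBounds_spec (fuel n : ℕ) :
    (sqrtBounds fuel n).1 * (sqrtBounds fuel n).1 ≤ n ∧ n < (sqrtBounds fuel n).2 * (sqrtBounds fuel n).2 :=
  sqrtBisect_spec n fuel 0 (n + 1) (by simp) (by nlinarith)

/-- Interval extension of `√·` (`√x = 0` for `x ≤ 0`): `(r(l S) or 0, r'(u S) or +∞)` by `sqrtBounds` with fuel `fuel`.
[cite: Melquiond2008, Sect. 2.2] -/
def sqrt (S fuel : ℕ) (I : XI) : XI :=
  ⟨some (match I.lo with
      | some l => ((sqrtBounds fuel (l.toNat * S)).1 : ℤ)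
      | none => 0),
    match I.hi with
    | some h => some ((sqrtBounds fuel (h.toNat * S)).2 : ℤ)
    | none => none⟩

/-- Interval extension of `√·`. [cite: Melquiond2008, Sect. 2.2] -/
theorem mem_sqrt (hS : 0 < S) {fuel : ℕ} (hx : mem S x I) : mem S (Real.sqrt x) (sqrt S fuel I) := by
  have hSr : (0 : ℝ) < S := by exact_mod_cast hS
  obtain ⟨hx1, hx2⟩ := hx
  have hb : 0 ≤ Real.sqrt x * S := by positivity
  refine ⟨?_, ?_⟩
  · rcases I with ⟨_ | l, hi⟩
    · show ((0 : ℤ) : ℝ) ≤ Real.sqrt x * S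
      simpa using hb
    · simp only [LB_some] at hx1
      show (((sqrtBounds fuel (l.toNat * S)).1 : ℤ) : ℝ) ≤ Real.sqrt x * S
      set r := (sqrtBounds fuel (l.toNat * S)).1 with hr
      have hrr : r * r ≤ l.toNat * S := (sqrtBounds_spec fuel (l.toNat * S)).1
      by_cases hl : 0 < l
      · have hlr : (0 : ℝ) < l := by exact_mod_cast hl
        have hx0 : 0 ≤ x := by
          by_contra h
          push Not at h
          nlinarith
        have hln : ((l.toNat : ℕ) : ℝ) = (l : ℝ) := by
          have : (l.toNat : ℤ) = l := Int.toNat_of_nonneg hl.le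
          exact_mod_cast this
        have hsq : ((r : ℕ) : ℝ) ^ 2 ≤ (Real.sqrt x * S) ^ 2 := by
          have h1 : ((r : ℕ) : ℝ) ^ 2 ≤ ((l.toNat * S : ℕ) : ℝ) := by
            rw [pow_two]; exact_mod_cast hrr
          have h2 : ((l.toNat * S : ℕ) : ℝ) ≤ (Real.sqrt x * S) ^ 2 := by
            push_cast
            rw [hln, mul_pow, Real.sq_sqrt hx0]
            nlinarith
          exact h1.trans h2
        have := (pow_le_pow_iff_left₀ (by positivity) hb two_ne_zero).1 hsq
        exact_mod_cast this
      · have h0 : l.toNat = 0 := Int.toNat_eq_zero.2 (not_lt.1 hl)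
        have : r = 0 := by
          have : r * r ≤ 0 := by simpa [h0] using hrr
          rcases Nat.eq_zero_or_pos r with h | h
          · exact h
          · exact absurd this (not_le.2 (Nat.mul_pos h h))
        rw [this]
        simpa using hb
  · rcases I with ⟨lo, _ | h⟩
    · trivial
    · simp only [UB_some] at hx2
      show Real.sqrt x * S ≤ (((sqrtBounds fuel (h.toNat * S)).2 : ℤ) : ℝ)
      set r := (sqrtBounds fuel (h.toNat * S)).2 with hr
      have hrr : h.toNat * S < r * r := (sqrtBounds_spec fuel (h.toNat * S)).2
      by_cases hx0 : 0 < x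
      · have hxS : 0 < x * S := by positivity
        have hh : (0 : ℝ) < h := hxS.trans_le hx2
        have hhz : 0 ≤ h := by exact_mod_cast hh.le
        have hhn : ((h.toNat : ℕ) : ℝ) = (h : ℝ) := by
          have : (h.toNat : ℤ) = h := Int.toNat_of_nonneg hhz
          exact_mod_cast this
        have hsq : (Real.sqrt x * S) ^ 2 < ((r : ℕ) : ℝ) ^ 2 := by
          have h1 : ((h.toNat * S : ℕ) : ℝ) < ((r : ℕ) : ℝ) ^ 2 := by
            rw [pow_two]; exact_mod_cast hrr
          have h2 : (Real.sqrt x * S) ^ 2 ≤ ((h.toNat * S : ℕ) : ℝ) := by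
            push_cast
            rw [hhn, mul_pow, Real.sq_sqrt hx0.le]
            nlinarith
          exact h2.trans_lt h1
        have := lt_of_pow_lt_pow_left₀ 2 (by positivity) hsq
        exact_mod_cast this.le
      · rw [Real.sqrt_eq_zero'.2 (not_lt.1 hx0), zero_mul]
        positivity

/-- Upper bound of `log` on an interval with positive lower bound `l`: from `log (max u l / S)` (`+∞` if `u = +∞`
or the enclosure is refused). [cite: Melquiond2008, Sect. 2.2] -/
def logHi (S K : ℕ) (l : ℤ) : Option ℤ → Option ℤ
  | some h =>
    match MI.logPos S K ⟨max h l, max h l⟩ with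
    | some B => some B.hi
    | none => none
  | none => none

/-- Interval extension of `log` (`⊤` unless a positive lower bound is certified by `MI.logPos`): lower bound from
`log (l/S)`, upper by `logHi`. [cite: Melquiond2008, Sect. 2.2] -/
def log (S K : ℕ) : XI → XI
  | ⟨some l, hi⟩ =>
    match MI.logPos S K ⟨l, l⟩ with
    | some A => ⟨some A.lo, logHi S K l hi⟩
    | none => top
  | ⟨none, _⟩ => top

/-- [folklore] -/
private theorem mem_point {S : ℕ} (hS : 0 < S) (l : ℤ) : MI.mem S ((l : ℝ) / S) ⟨l, l⟩ := by
  have hSr : (0 : ℝ) < S := by exact_mod_cast hS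
  constructor <;> simp [div_mul_cancel₀ _ hSr.ne']

/-- [folklore] -/
private theorem UB_logHi (hS : 0 < S) {K : ℕ} {l : ℤ} {hi : Option ℤ} (hx0 : 0 < x) (hx2 : UB S x hi) :
    UB S (Real.log x) (logHi S K l hi) := by
  have hSr : (0 : ℝ) < S := by exact_mod_cast hS
  rcases hi with _ | h
  · trivial
  · simp only [UB_some] at hx2
    rw [logHi]
    split
    · rename_i B hB
      obtain ⟨hm0, hmB⟩ := MI.mem_logPos hS hB (mem_point hS (max h l))
      show Real.log x * S ≤ B.hi
      have hxm : x ≤ ((max h l : ℤ) : ℝ) / S := by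
        rw [le_div_iff₀ hSr]
        exact hx2.trans (by exact_mod_cast le_max_left h l)
      have h2 : Real.log x ≤ Real.log (((max h l : ℤ) : ℝ) / S) := Real.log_le_log hx0 hxm
      have h1 := hmB.2
      nlinarith
    · trivial

/-- Interval extension of `log`. [cite: Melquiond2008, Sect. 2.2] -/
theorem mem_log (hS : 0 < S) {K : ℕ} (hx : mem S x I) : mem S (Real.log x) (log S K I) := by
  have hSr : (0 : ℝ) < S := by exact_mod_cast hS
  obtain ⟨hx1, hx2⟩ := hx
  rcases I with ⟨_ | l, hi⟩
  · exact mem_top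
  · simp only [LB_some] at hx1
    rw [log]
    split
    · rename_i A hA
      obtain ⟨hl0, hlA⟩ := MI.mem_logPos hS hA (mem_point hS l)
      have hlx : (l : ℝ) / S ≤ x := by rw [div_le_iff₀ hSr]; exact hx1
      have hx0 : 0 < x := hl0.trans_le hlx
      refine ⟨?_, UB_logHi hS hx0 hx2⟩
      show (A.lo : ℝ) ≤ Real.log x * S
      have h1 := hlA.1
      have h2 : Real.log ((l : ℝ) / S) ≤ Real.log x := Real.log_le_log hl0 hlx
      nlinarith
    · exact mem_top

/-- Interval extension of `exp` (monotone; lower bound `0` where `MI.expPt` is refused or the operand is unbounded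
below). [cite: Melquiond2008, Sect. 2.2] -/
def exp (S Ke ke : ℕ) (I : XI) : XI :=
  ⟨some (match I.lo with
      | some l =>
        (match MI.expPt S Ke ke ⟨l, l⟩ with
          | some A => max A.lo 0
          | none => 0)
      | none => 0),
    match I.hi with
    | some h =>
      (match MI.expPt S Ke ke ⟨h, h⟩ with
        | some B => some B.hi
        | none => none)
    | none => none⟩

/-- Interval extension of `exp`. [cite: Melquiond2008, Sect. 2.2] -/
theorem mem_exp (hS : 0 < S) {Ke ke : ℕ} (hx : mem S x I) : mem S (Real.exp x) (exp S Ke ke I) := by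
  have hSr : (0 : ℝ) < S := by exact_mod_cast hS
  obtain ⟨hx1, hx2⟩ := hx
  have he0 : 0 ≤ Real.exp x * S := by positivity
  refine ⟨?_, ?_⟩
  · rcases I with ⟨_ | l, hi⟩
    · show ((0 : ℤ) : ℝ) ≤ Real.exp x * S
      simpa using he0
    · simp only [LB_some] at hx1
      show (((match MI.expPt S Ke ke ⟨l, l⟩ with | some A => max A.lo 0 | none => 0) : ℤ) : ℝ) ≤ Real.exp x * S
      split
      · rename_i A hA
        have hlA := MI.mem_expPt hS hA (mem_point hS l)
        have hlx : (l : ℝ) / S ≤ x := by rw [div_le_iff₀ hSr]; exact hx1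
        have h2 : Real.exp ((l : ℝ) / S) ≤ Real.exp x := Real.exp_le_exp.2 hlx
        have h1 := hlA.1
        push_cast
        refine max_le ?_ he0
        nlinarith
      · simpa using he0
  · rcases I with ⟨lo, _ | h⟩
    · trivial
    · simp only [UB_some] at hx2
      show UB S (Real.exp x) (match MI.expPt S Ke ke ⟨h, h⟩ with | some B => some B.hi | none => none)
      split
      · rename_i B hB
        have hhB := MI.mem_expPt hS hB (mem_point hS h)
        show Real.exp x * S ≤ B.hi
        have hxh : x ≤ (h : ℝ) / S := by rw [le_div_iff₀ hSr]; exact hx2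
        have h2 : Real.exp x ≤ Real.exp ((h : ℝ) / S) := Real.exp_le_exp.2 hxh
        have h1 := hhB.2
        nlinarith
      · trivial

end XI

end NumericsMP

/-! ### The range of a straight-line program on a half-line -/

namespace PolyMP

open Literature.Analysis.ValidatedNumerics.NumericsMP
open Literature.Analysis.ValidatedNumerics.ExpPoly (Poly BPoly)
open Literature.Analysis.ValidatedNumerics.ExpPoly

/-- Precisions of the transcendental enclosures used by the range evaluator (`MI.expPt S Ke ke`, `MI.logPos S Kl`).
[cite: Melquiond2008, Sect. 3.3] -/
structure XPrm where
  /-- number of Taylor terms of `MI.expPt` -/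
  Ke : ℕ := 30
  /-- argument halvings of `MI.expPt` -/
  ke : ℕ := 8
  /-- number of series terms of `MI.logPos` -/
  Kl : ℕ := 40
  /-- bisection fuel of `XI.sqrt` (any value above `log₂` of the scaled operands gives the exact integer roots) -/
  ks : ℕ := 640
  deriving Repr, Inhabited, DecidableEq

/-- Horner evaluation of an exact rational polynomial over an extended interval. [cite: Melquiond2008, Sect. 3.3] -/
def polyRangeX (S : ℕ) (V : XI) : Poly → XI
  | [] => XI.zero
  | [c] => XI.ofMI (ofRat S c)
  | c :: g => XI.add (XI.ofMI (ofRat S c)) (XI.mul S V (polyRangeX S V g))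

/-- Soundness of the Horner range. [cite: Melquiond2008, Sect. 3.3] -/
theorem mem_polyRangeX {S : ℕ} (hS : 0 < S) {v : ℝ} {V : XI} (hv : XI.mem S v V) :
    ∀ g : Poly, XI.mem S (Poly.eval g v) (polyRangeX S V g)
  | [] => by simpa [polyRangeX] using (XI.mem_zero (S := S))
  | [c] => by simpa [polyRangeX] using XI.mem_ofMI (mem_ofRat S c)
  | c :: d :: g => by
      show XI.mem S _ (XI.add (XI.ofMI (ofRat S c)) (XI.mul S V (polyRangeX S V (d :: g))))
      rw [Poly.eval_cons]
      exact XI.mem_add (XI.mem_ofMI (mem_ofRat S c)) (XI.mem_mul hS hv (mem_polyRangeX hS hv (d :: g)))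

/-- [folklore] -/
private theorem eval_recenterAt' (g : Poly) (c : ℚ) (u : ℝ) :
    Poly.eval (recenterAt g c) u = Poly.eval g ((c : ℝ) + u) := by
  rw [recenterAt, BPoly.eval_subst, BPoly.eval_taylor]
  simp [Poly.eval, add_comm]

/-- **The interval extension of one statement on the half-line `[u, +∞)`**: given the extended intervals `rs` of
the registers (valid at the point `x ≥ u`), the extended interval of the statement's value at `x`; the statements in
the variable (`poly g`, `expAff a b`) are recentred at `u` exactly, so that the variable's interval is `[0, +∞)`.
[cite: Melquiond2008, Sect. 3.3] -/
def SOp.rangeX (S : ℕ) (P : XPrm) (u : ℚ) (rs : List XI) : SOp → XI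
  | .poly g => polyRangeX S XI.nonnegHL (recenterAt g u)
  | .expAff a b =>
      XI.exp S P.Ke P.ke (XI.add (XI.ofMI (ofRat S (a + b * u))) (XI.mul S (XI.ofMI (ofRat S b)) XI.nonnegHL))
  | .neg i => XI.neg (getReg XI.zero rs i)
  | .add i j => XI.add (getReg XI.zero rs i) (getReg XI.zero rs j)
  | .mul i j => XI.mul S (getReg XI.zero rs i) (getReg XI.zero rs j)
  | .inv i => XI.inv S (getReg XI.zero rs i)
  | .sqrt i => XI.sqrt S P.ks (getReg XI.zero rs i)
  | .log i => XI.log S P.Kl (getReg XI.zero rs i)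
  | .exp i => XI.exp S P.Ke P.ke (getReg XI.zero rs i)

/-- **Stack invariant at a point**: every register function's value at `x` lies in the register's extended interval
(defaults `0` / `XI.zero` past the bottom match). [cite: Melquiond2008, Sect. 3.3] -/
def XStackAt (S : ℕ) (x : ℝ) (fs : List (ℝ → ℝ)) (rs : List XI) : Prop :=
  ∀ i : ℕ, XI.mem S (getReg (fun _ => (0 : ℝ)) fs i x) (getReg XI.zero rs i)

/-- [folklore] -/
private theorem xstackAt_nil (S : ℕ) (x : ℝ) : XStackAt S x [] [] := fun i => by
  rw [getReg_nil, getReg_nil]; exact XI.mem_zero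

/-- [folklore] -/
private theorem XStackAt.cons {S : ℕ} {x : ℝ} {fs : List (ℝ → ℝ)} {rs : List XI} {f : ℝ → ℝ} {R : XI}
    (hf : XI.mem S (f x) R) (hst : XStackAt S x fs rs) : XStackAt S x (f :: fs) (R :: rs) := fun i => by
  cases i with
  | zero => simpa using hf
  | succ i => simpa using hst i

/-- **Soundness of the statement extension** at every point `x ≥ u`. [cite: Melquiond2008, Sect. 3.3] -/
theorem SOp.mem_rangeX {S : ℕ} (hS : 0 < S) (P : XPrm) {u : ℚ} {x : ℝ} (hx : (u : ℝ) ≤ x)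
    {fs : List (ℝ → ℝ)} {rs : List XI} (hst : XStackAt S x fs rs) :
    ∀ op : SOp, XI.mem S (op.evalF fs x) (op.rangeX S P u rs)
  | .poly g => by
      have hv : XI.mem S (x - u) XI.nonnegHL := XI.mem_nonnegHL (by linarith)
      have := mem_polyRangeX hS hv (recenterAt g u)
      rw [eval_recenterAt', show ((u : ℚ) : ℝ) + (x - u) = x by ring] at this
      exact this
  | .expAff a b => by
      have hv : XI.mem S (x - u) XI.nonnegHL := XI.mem_nonnegHL (by linarith)
      have harg := XI.mem_add (XI.mem_ofMI (mem_ofRat S (a + b * u)))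
        (XI.mem_mul hS (XI.mem_ofMI (mem_ofRat S b)) hv)
      have e : (((a + b * u : ℚ) : ℝ) + (b : ℝ) * (x - u)) = (a : ℝ) + b * x := by push_cast; ring
      rw [e] at harg
      exact XI.mem_exp hS harg
  | .neg i => XI.mem_neg (hst i)
  | .add i j => XI.mem_add (hst i) (hst j)
  | .mul i j => XI.mem_mul hS (hst i) (hst j)
  | .inv i => XI.mem_inv hS (hst i)
  | .sqrt i => XI.mem_sqrt hS (hst i)
  | .log i => XI.mem_log hS (hst i)
  | .exp i => XI.mem_exp hS (hst i)

/-- Run a program on a stack of extended intervals. [cite: Melquiond2008, Sect. 3.3] -/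
def SProg.runX (S : ℕ) (P : XPrm) (u : ℚ) : SProg → List XI → List XI
  | [], rs => rs
  | op :: p, rs => SProg.runX S P u p (op.rangeX S P u rs :: rs)

/-- [folklore] -/
private theorem xstackAt_runX {S : ℕ} (hS : 0 < S) (P : XPrm) {u : ℚ} {x : ℝ} (hx : (u : ℝ) ≤ x) :
    ∀ (p : SProg) {fs : List (ℝ → ℝ)} {rs : List XI}, XStackAt S x fs rs →
      XStackAt S x (p.runF fs) (p.runX S P u rs)
  | [], _, _, hst => by simpa [SProg.runF, SProg.runX] using hst
  | op :: p, fs, rs, hst => by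
      rw [SProg.runF, SProg.runX]
      exact xstackAt_runX hS P hx p (XStackAt.cons (SOp.mem_rangeX hS P hx hst op) hst)

/-- The extended intervals of the initial stack: the parameter box. [cite: MahboubiMelquiondSibutpinote2016, Sect. 4.1] -/
def constRanges (S : ℕ) (B : PBox) : List XI := B.map fun b => XI.ofMI (boxI S b)

/-- [folklore] -/
private theorem xstackAt_const (S : ℕ) (x : ℝ) :
    ∀ {ps : List ℝ} {B : PBox}, BoxMem ps B → XStackAt S x (constStack ps) (constRanges S B)
  | _, _, List.Forall₂.nil => by simpa [constStack, constRanges] using xstackAt_nil S x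
  | _, _, List.Forall₂.cons (a := c) (b := b) hb hrest => by
      simp only [constStack, constRanges, List.map_cons]
      exact XStackAt.cons (f := fun _ => c) (XI.mem_ofMI (mem_boxI S hb.1 hb.2))
        (by simpa [constStack, constRanges] using xstackAt_const S x hrest)

/-- **The range of a program on the half-line** `[u, +∞)` for parameters in the box `B`: "`F(hull(u, +∞))`".
[cite: MahboubiMelquiondSibutpinote2018, Sect. 4.1 Lemma 5] -/
def SProg.rangeHL (S : ℕ) (P : XPrm) (p : SProg) (B : PBox) (u : ℚ) : XI :=
  getReg XI.zero (p.runX S P u (constRanges S B)) 0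

/-- **Soundness of the half-line range**: `p(x, ps) ∈ p.rangeHL S P B u` for every `x ≥ u` and `ps ∈ B`.
[cite: MahboubiMelquiondSibutpinote2018, Sect. 4.1 Lemma 5] -/
theorem SProg.mem_rangeHL {S : ℕ} (hS : 0 < S) (P : XPrm) {p : SProg} {ps : List ℝ} {B : PBox} (hB : BoxMem ps B)
    {u : ℚ} {x : ℝ} (hx : (u : ℝ) ≤ x) : XI.mem S (p.toFunP ps x) (p.rangeHL S P B u) :=
  xstackAt_runX hS P hx p (xstackAt_const S x hB) 0

/-! ### Measurability of the denoted function (as in `…CertParam.lean`, where it is private) -/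

/-- [folklore] -/
private theorem measurable_evalF'' {fs : List (ℝ → ℝ)} (hfs : ∀ i, Measurable (getReg (fun _ => (0 : ℝ)) fs i)) :
    ∀ op : SOp, Measurable (op.evalF fs)
  | SOp.poly g => (Poly.continuous_eval g).measurable
  | SOp.expAff a b => by
      show Measurable fun t : ℝ => Real.exp ((a : ℝ) + b * t)
      exact Real.measurable_exp.comp (measurable_const.add (measurable_const.mul measurable_id))
  | SOp.neg i => (hfs i).neg
  | SOp.add i j => (hfs i).add (hfs j)
  | SOp.mul i j => (hfs i).mul (hfs j)
  | SOp.inv i => (hfs i).inv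
  | SOp.sqrt i => Real.continuous_sqrt.measurable.comp (hfs i)
  | SOp.log i => Real.measurable_log.comp (hfs i)
  | SOp.exp i => Real.measurable_exp.comp (hfs i)

/-- [folklore] -/
private theorem measurable_getReg_cons'' {f : ℝ → ℝ} {fs : List (ℝ → ℝ)} (hf : Measurable f)
    (hfs : ∀ i, Measurable (getReg (fun _ => (0 : ℝ)) fs i)) :
    ∀ i, Measurable (getReg (fun _ => (0 : ℝ)) (f :: fs) i)
  | 0 => by simpa using hf
  | i + 1 => by simpa using hfs i

/-- [folklore] -/
private theorem measurable_runF'' : ∀ (p : SProg) (fs : List (ℝ → ℝ)),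
    (∀ i, Measurable (getReg (fun _ => (0 : ℝ)) fs i)) →
      ∀ i, Measurable (getReg (fun _ => (0 : ℝ)) (p.runF fs) i)
  | [], fs, hfs => by simpa [SProg.runF] using hfs
  | op :: p, fs, hfs => by
      rw [SProg.runF]
      exact measurable_runF'' p _ (measurable_getReg_cons'' (measurable_evalF'' hfs op) hfs)

/-- [folklore] -/
private theorem measurable_constStack' : ∀ (ps : List ℝ) (i : ℕ),
    Measurable (getReg (fun _ => (0 : ℝ)) (constStack ps) i)
  | [], i => by rw [constStack, List.map_nil, getReg_nil]; exact measurable_const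
  | c :: ps, 0 => by
      simp only [constStack, List.map_cons, getReg_cons_zero]
      exact measurable_const
  | c :: ps, i + 1 => by simpa [constStack] using measurable_constStack' ps i

/-- [folklore] -/
private theorem measurable_toFunP' (p : SProg) (ps : List ℝ) : Measurable (p.toFunP ps) := by
  unfold SProg.toFunP
  exact measurable_runF'' p (constStack ps) (measurable_constStack' ps) 0

/-! ### The automatic remainder certificate -/

/-- **KERNEL CHECK (automatic Lemma 5)**: the bounded factor `p(·, ps)` has a FINITE natural interval extension on
`[u, +∞)`, and the interval-form certificate of the previous file accepts it: `S·∫_{(u,∞)} p·g ∈ [lo, hi]`.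
[cite: MahboubiMelquiondSibutpinote2018, Sect. 4.1 Lemma 5] -/
def tailCheck (S : ℕ) (P : XPrm) (s : Scale) (p : SProg) (B : PBox) (u : ℚ) (lo hi : ℤ) : Bool :=
  decide (0 < S) &&
    match (p.rangeHL S P B u).fin? with
    | some F => tailCheckI S P.Ke P.ke P.Kl s u F lo hi
    | none => false

/-- **Soundness of the automatic remainder certificate**: for all parameters in the box, the remainder
`∫_{(u,∞)} p(x, ps)·g(x) dx` is integrable and `S`-times it lies in `[lo, hi]`.
[cite: MahboubiMelquiondSibutpinote2018, Sect. 4.1 Lemma 5] -/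
theorem ftailOK_of_tailCheck {S : ℕ} {P : XPrm} {s : Scale} {p : SProg} {B : PBox} {u : ℚ} {lo hi : ℤ}
    (hc : tailCheck S P s p B u lo hi = true) {ps : List ℝ} (hB : BoxMem ps B) :
    FTailOK (fun x => p.toFunP ps x * s.toFun x) S u lo hi := by
  unfold tailCheck at hc
  simp only [Bool.and_eq_true, decide_eq_true_eq] at hc
  obtain ⟨hS, hc⟩ := hc
  split at hc
  · rename_i F hF
    exact ftailOK_of_tailCheckI hc (measurable_toFunP' p ps).aestronglyMeasurable
      fun x hx => XI.mem_fin? hF (SProg.mem_rangeHL hS P hB hx.le)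
  · exact absurd hc Bool.false_ne_true

/-! ### Gluing a proper part and a remainder -/

/-- **Splitting an improper integral** `∫_{(a,∞)} f = ∫_a^b f + ∫_{(b,∞)} f`: an enclosure of the proper part
(with interval integrability on `[a, b]`) and an enclosure-with-integrability of the remainder give an enclosure of
the improper integral and its integrability. [cite: MahboubiMelquiondSibutpinote2018, Sect. 4.1] -/
theorem integral_Ioi_of_seg_tail {f : ℝ → ℝ} {a b lo₁ hi₁ lo₂ hi₂ : ℝ} (hab : a ≤ b)
    (hfi : IntervalIntegrable f volume a b)
    (h₁ : lo₁ ≤ ∫ x in a..b, f x ∧ ∫ x in a..b, f x ≤ hi₁)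
    (hft : IntegrableOn f (Ioi b))
    (h₂ : lo₂ ≤ ∫ x in Ioi b, f x ∧ ∫ x in Ioi b, f x ≤ hi₂) :
    IntegrableOn f (Ioi a) ∧ lo₁ + lo₂ ≤ ∫ x in Ioi a, f x ∧ ∫ x in Ioi a, f x ≤ hi₁ + hi₂ := by
  have hIoc := (intervalIntegrable_iff_integrableOn_Ioc_of_le hab).1 hfi
  have hIoi : IntegrableOn f (Ioi a) := by
    rw [← Ioc_union_Ioi_eq_Ioi hab]
    exact hIoc.union hft
  have e := intervalIntegral.integral_interval_add_Ioi hIoi hft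
  refine ⟨hIoi, ?_, ?_⟩ <;> rw [← e] <;> linarith [h₁.1, h₁.2, h₂.1, h₂.2]

/-- **From a remainder certificate to real bounds with integrability** (the form consumed by
`integral_Ioi_of_seg_tail`). [cite: MahboubiMelquiondSibutpinote2018, Sect. 4.1 Lemma 5] -/
theorem FTailOK.realBounds {φ : ℝ → ℝ} {S : ℕ} {u : ℚ} {lo hi : ℤ} (h : FTailOK φ S u lo hi) (hS : 0 < S) :
    IntegrableOn φ (Ioi (u : ℝ)) ∧ (lo : ℝ) / S ≤ ∫ x in Ioi (u : ℝ), φ x ∧ ∫ x in Ioi (u : ℝ), φ x ≤ (hi : ℝ) / S := by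
  obtain ⟨h1, h2, hi⟩ := h
  have hSr : (0 : ℝ) < S := by exact_mod_cast hS
  refine ⟨hi, ?_, ?_⟩
  · rw [div_le_iff₀ hSr]; linarith
  · rw [le_div_iff₀ hSr]; linarith

end PolyMP

end Literature.Analysis.ValidatedNumerics
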